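/-
Origin: expansion seat `planner-pub-hodgecm-toy2-g2-0`, handover #6 2026-08-18T05:30:48Z (`HOME/pub-hodgecm-toy2-g2/lean/Toy2g2/ToyFFacts.lean`, md5 57df66b1, 137 lines);
landed by the gen-6 packager in gate run 23 as `HodgeCM/Model/Toy/ToyFFacts.lean` (verbatim).
-/
-- HANDOVER (planner-pub-hodgecm-toy2-g2-0, unit pub-hodgecm-toy2-g2): WIP module `Toy2g2.ToyFFacts`; intended final
-- module `HodgeCM.Model.Toy.ToyFFacts` (kind L5, toy model / consistency witness).  Imports are FINAL package names.
/-
Copyright: pub-hodgecm cell (HodgeCMPerL). Consistency-witness layer (part (e), referee A G4).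

# The class-M candidates F4, F5, F6, F7 of the geometric `[QW8]` route in the exterior CM-model

The geometric (Milne-free) route to `HC_CM` (`StubTree/Qw8Geometric.lean`, `StubTree/Qw8MilneZero.lean`,
`Assembly/OpenInputsGeometric.lean`) takes as inputs, besides `ModelAxioms` and N1–N4, the five facts
F2 `Fact_factorActDescends`, F4 `Fact_cupAlg`, F5 `Fact_cupAssoc`, F6 `Fact_weightDual`, F7 `Fact_gysin`.
N1–N4 hold in the exterior model (`HodgeCM/Model/Toy/CupFacts.lean`).  Here, for the exterior model
`toyModelWith D` (any Hodge datum `D` unless stated):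

* `fact_cupAssoc`  — F5 HOLDS (the cup product is exterior multiplication, which is associative);
* `fact_cupAlg`    — F4 HOLDS for the exterior Hodge datum (from N2 `fact_cup_hodge`: Hodge types add under `∧`);
* `fact_gysin`     — F7 HOLDS, VACUOUSLY: the model's trace is `0`, so `gy := 0` satisfies both clauses
                     (F7 as typed does not force a non-zero Gysin map in a trace-free universe);
* `not_fact_weightDual` — F6 is FALSE: it demands `trC (w' ∪ w) ≠ 0` for some `w'`, impossible when `tr = 0`
                     (witness: degree `0`, weight `∅`, `w = 1 ⊗ 1 ∈ ℂ ⊗ ⋀⁰ L`, a weight vector by N3).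

Consequence (`geometricInputs_not_witnessed`): the exterior model satisfies `ModelAxioms` (toy seat's
`toyModel_modelAxioms`), N1–N4, F4, F5, F7 but NOT F6, so — unlike `ModelAxioms` itself — the input list of
the geometric route is NOT shown consistent by this model; any model of F6 needs a non-zero trace functional.
Nothing here is an input of `perL`; these are audit facts about the alternative `[QW8]` supply line.
-/
import Summits.HodgeConjecture.HodgeCM.Model.Toy.CupFacts
import Summits.HodgeConjecture.HodgeCM.Model.Inhabited
import Summits.HodgeConjecture.HodgeCM.StubTree.Qw8Geometric

namespace HodgeCM.Toy

open Literature.AlgebraicGeometry.Motives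
open Literature.AlgebraicGeometry.Motives.HodgeStructure (ofRat mem_hodgeClasses_iff)
open scoped TensorProduct
open exteriorPower

noncomputable section

variable (D : HodgeData)

/-! ### F5 — associativity of the cup product -/

/-- degree transport does not change the underlying element of the exterior algebra -/
lemma coe_castCoh (X : Obj) {k l : ℕ} (h : k = l) (z : (toyModelWith D).Coh X k) :
    (((toyModelWith D).castCoh X h z : ⋀[ℚ]^l X.L) : ExteriorAlgebra ℚ X.L) =
      ((z : ⋀[ℚ]^k X.L) : ExteriorAlgebra ℚ X.L) := by
  subst h; rfl

/-- **F5 in the exterior model** (any Hodge datum): `(a ∪ b) ∪ c = a ∪ (b ∪ c)` up to the degree transport,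
because `∪ = ∧` is the (associative) multiplication of the exterior algebra `⋀ L X`. -/
theorem fact_cupAssoc : (toyModelWith D).Fact_cupAssoc := by
  intro X i j k a b c
  apply Subtype.ext
  rw [coe_castCoh]
  show (((a : ⋀[ℚ]^i X.L) : ExteriorAlgebra ℚ X.L) * (b : ⋀[ℚ]^j X.L)) * (c : ⋀[ℚ]^k X.L) =
    ((a : ⋀[ℚ]^i X.L) : ExteriorAlgebra ℚ X.L) * ((b : ⋀[ℚ]^j X.L) * (c : ⋀[ℚ]^k X.L))
  exact mul_assoc _ _ _

/-! ### F4 — algebraic classes are closed under cup product (exterior Hodge datum) -/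

/-- membership of a degree-transported class in `alg^r` is membership of `1 ⊗ z` in `F^r` -/
lemma castCoh_mem_alg_iff (X : Obj) {k r : ℕ} (h : k = 2 * r) (z : (toyModelWith D).Coh X k) :
    (toyModelWith D).castCoh X h z ∈ (toyModelWith D).alg X r ↔ ofRat z ∈ (D.hs X k).F (r : ℤ) := by
  subst h; exact mem_hodgeClasses_iff _ _ _

/-- **F4 in the exterior model** (exterior Hodge datum): `alg^p ∪ alg^q ⊆ alg^{p+q}`, from N2 `fact_cup_hodge`
(`F^p ∪ F^q ⊆ F^{p+q}`) and `alg^p = {x | 1 ⊗ x ∈ F^p H^{2p}}`. -/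
theorem fact_cupAlg : (toyModelWith exteriorHodgeData).Fact_cupAlg := by
  intro X p q x y hx hy
  rw [castCoh_mem_alg_iff]
  have hx' : ofRat x ∈ (exteriorHodgeData.hs X (2 * p)).F (p : ℤ) := (mem_hodgeClasses_iff _ _ _).mp hx
  have hy' : ofRat y ∈ (exteriorHodgeData.hs X (2 * q)).F (q : ℤ) := (mem_hodgeClasses_iff _ _ _).mp hy
  have hc := fact_cup_hodge X (2 * p) (2 * q) (p : ℤ) (q : ℤ) (ofRat x) (ofRat y) hx' hy'
  rw [ofRat_eq, ofRat_eq, Universe.cupC_tmul, mul_one] at hc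
  rw [ofRat_eq]
  push_cast
  exact hc

/-! ### F7 — the Gysin map, vacuously -/

/-- **F7 in the exterior model** (any Hodge datum), vacuously: with `tr = 0` the zero map is a Gysin map. -/
theorem fact_gysin : (toyModelWith D).Fact_gysin := by
  intro F n m Ξ pA pB _
  refine ⟨fun k => 0, fun p z _ => Submodule.zero_mem _, fun k e ω => ?_⟩
  rw [LinearMap.zero_apply, tr_eq, LinearMap.zero_apply, zero_smul]

/-! ### F6 — weight duality FAILS (the trace is zero) -/

/-- the complexified trace of the exterior model vanishes identically -/
lemma trC_eq_zero (X : Obj) (k : ℕ) : (toyModelWith D).trC X k = 0 := by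
  rw [Universe.trC, tr_eq, LinearMap.baseChange_zero, LinearMap.comp_zero]

/-- in degree `0`, every class of `ℂ ⊗ ⋀⁰ L` is a weight vector of weight `∅` (N3: `f^* = id` on `H⁰`) -/
lemma isWeightVector_zero (F : CMField) {n : ℕ} (Θ : Fin (n + 1) → CMType F)
    (w : (toyModelWith D).CohC ((toyModelWith D).cmProd F Θ) 0) :
    (toyModelWith D).IsWeightVector F Θ (fun _ => ∅) 0 w := by
  intro j a M _
  rw [Finset.prod_empty, one_smul, Universe.pullC, fact_pull_H0 D _ M, LinearMap.baseChange_id,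
    LinearMap.id_apply]

/-- **F6 fails in the exterior model** (any Hodge datum): `Fact_weightDual` asks, for every non-zero weight
vector `w`, for a partner `w'` with `trC (w' ∪ w) ≠ 0`; with `tr = 0` this is impossible.  Witness: a CM field
`F` (from `faceHypothesesInhabited`), one factor, degree `0`, weight `∅`, `w = 1 ⊗ b` for a basis vector `b`
of `⋀⁰ L ≅ ℚ`. -/
theorem not_fact_weightDual : ¬ (toyModelWith D).Fact_weightDual := by
  intro h6
  obtain ⟨F, -, -, f, -, -⟩ := faceHypothesesInhabited
  let Θ : Fin (0 + 1) → CMType F := fun _ => f.Φ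
  let X : Obj := (toyModelWith D).cmProd F Θ
  let b : Module.Basis Unit ℚ (⋀[ℚ]^0 X.L) :=
    (Module.Basis.singleton Unit ℚ).map (exteriorPower.zeroEquiv ℚ X.L).symm
  let w : (toyModelWith D).CohC X (2 * 0) := Algebra.TensorProduct.basis ℂ b ()
  have hw : w ≠ 0 := (Algebra.TensorProduct.basis ℂ b).ne_zero ()
  have hW : (toyModelWith D).IsWeightVector F Θ (fun _ => ∅) (2 * 0) w := isWeightVector_zero D F Θ w
  obtain ⟨-, w', -, h1, -⟩ := h6 F 0 Θ 0 (fun _ => ∅) w hw hW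
  exact h1 (by rw [trC_eq_zero, LinearMap.zero_apply])

/-! ### Summary: the geometric route's input list is not witnessed by the exterior model -/

/-- In the exterior model (exterior Hodge datum): F4, F5, F7 hold and F6 fails. -/
theorem fFacts_profile :
    (toyModelWith exteriorHodgeData).Fact_cupAlg ∧ (toyModelWith exteriorHodgeData).Fact_cupAssoc ∧
      (toyModelWith exteriorHodgeData).Fact_gysin ∧ ¬ (toyModelWith exteriorHodgeData).Fact_weightDual :=
  ⟨fact_cupAlg, fact_cupAssoc _, fact_gysin _, not_fact_weightDual _⟩

/-- F6 is independent of `ModelAxioms` + N1–N4 + F4 + F5 + F7: the exterior model has all of these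
(`toyModel_modelAxioms`, `CupFacts`) and refutes F6.  In particular the hypothesis list of the geometric
route (`ModelAxioms`, N1–N4, F2, F4–F7) has no model in this package. -/
theorem weightDual_independent :
    ¬ ∀ U : Universe, U.ModelAxioms → U.Fact_cupExterior → U.Fact_cup_hodge → U.Fact_pull_H0 →
      U.Fact_hodge_F0 → U.Fact_cupAlg → U.Fact_cupAssoc → U.Fact_gysin → U.Fact_weightDual :=
  fun h => not_fact_weightDual exteriorHodgeData (h toyModel toyModel_modelAxioms (fact_cupExterior _)
    fact_cup_hodge (fact_pull_H0 _) fact_hodge_F0 fact_cupAlg (fact_cupAssoc _) (fact_gysin _))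

end

end HodgeCM.Toy
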